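import Literature.AlgebraicTopology.CharacteristicClasses.LineThomSplittingLocal
import Literature.AlgebraicTopology.CharacteristicClasses.LineThomClassLowDegree
import Literature.AlgebraicTopology.CharacteristicClasses.LineThomClassExistence
import Literature.AlgebraicTopology.SingularHomology.LerayHirschGlobal
import Literature.AlgebraicTopology.SingularHomology.LerayHirschEvenDegrees
import HarnessLib

/-!
# The Thom splitting `Hᵏ⁺²(B) ⊕ Hᵏ(B) ≅ Hᵏ⁺²(P(λ ⊕ ℂ))` of a complex line bundle, over a paracompact base

J. Milnor, J. Stasheff, *Characteristic Classes* (1974), §10 Thm. 10.4 (the Thom isomorphism of an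
oriented bundle over an ARBITRARY base: "first for bundles of finite type … then the general
case") and D. Husemoller, *Fibre Bundles* (3rd ed. 1994), Ch. 17 §1 Thm. 1.1 / §2 Thm. 2.5 (the
Leray–Hirsch form: `H*(E(Pξ))` is free over `H*(B)` on `1, a`), in the projective-completion model
of the tree: for a complex LINE bundle `λ` over a paracompact Hausdorff `B`, `π : P(λ ⊕ ℂ) → B`,
and any class `t ∈ H²(P(λ ⊕ ℂ); R)` restricting on every fibre `ℙ(λ_b ⊕ ℂ) ≅ ℂP¹` to the
canonical generator `ω_b(1)` (e.g. a Thom class, `IsThomClass`),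

* `thomSplit_bijective`: **`(x, y) ↦ π^*x + π^*y ⌣ t : Hᵏ⁺²(B) × Hᵏ(B) → Hᵏ⁺²(P(λ ⊕ ℂ))` is
  bijective** for every `k`;
* `map_complProj_bijective_of_le_one`: `π^* : Hᵏ(B) → Hᵏ(P(λ ⊕ ℂ))` is bijective for `k ≤ 1`.

Proof: the local statement over (any open subset of) a trivialising set is
`LineThomSplittingLocal.thomSplitOn_bijective` (+ the degrees `≤ 1`); it is globalised by the
Leray–Hirsch engine `LerayHirschGlobal.bijective_of_cover` (classes `1, t` in degrees `0, 2`;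
Milnor's countable cover, excision/five lemma, telescope). Everything is proved; no named facts.

## References

* J. Milnor, J. Stasheff, *Characteristic Classes*, PUP 1974, §10 Thm. 10.4. [MilnorStasheff1974]
* D. Husemoller, *Fibre Bundles*, GTM 20, Springer 1994, Ch. 17 §1 Thm. 1.1, §2 Thm. 2.5. [HusemollerFibreBundles1994]
-/

noncomputable section

open CategoryTheory Function Set Bundle Literature.AlgebraicTopology.SingularHomology
  Literature.AlgebraicTopology.SingularHomology.LerayHirsch
open scoped LinearAlgebra.Projectivization

universe u

namespace Literature.AlgebraicTopology.CharacteristicClasses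

variable {B : Type u} [TopologicalSpace B] (F : Type u) [NormedAddCommGroup F] [NormedSpace ℂ F] [FiniteDimensional ℂ F]
  (E : B → Type u) [∀ b, AddCommGroup (E b)] [∀ b, Module ℂ (E b)]
  [TopologicalSpace (TotalSpace F E)] [∀ b, TopologicalSpace (E b)] [FiberBundle F E] [VectorBundle ℂ F E]
  (hF : Module.finrank ℂ F = 1) (R : Type u) [CommRing R]

/-- The two Leray–Hirsch classes `1 ∈ H⁰`, `t ∈ H²` of `P(λ ⊕ ℂ)`. [cite: HusemollerFibreBundles1994, Ch. 17 §2 Thm. 2.5] -/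
abbrev thomPair (t : singularCohomology R R (ProjCompl F E) 2) :
    (j : Fin 2) → singularCohomology R R (ProjCompl F E) (evenDeg 2 j) :=
  pairCls R (singularCohomology.one R (ProjCompl F E)) t

section Local

variable (e : Trivialization F (π F E)) [MemTrivializationAtlas e]

include hF in
/-- **Over a trivialising `S`, `π^* : Hᵏ(S) → Hᵏ(P(λ ⊕ ℂ)|_S)` is bijective for `k ≤ 1`**
(`P(λ ⊕ ℂ)|_S ≅ S × ℂP¹` and the low-degree Künneth statement of `SphereLikeProductCohomology`).
[cite: MilnorStasheff1974, §10 pp. 111–113] -/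
theorem map_complProjOn_bijective_of_le_one {S : Set B} (hS : S ⊆ e.baseSet) {k : ℕ} (hk : k ≤ 1) :
    Bijective (singularCohomology.map R R (complProjOn F E S) k) := by
  rw [← fst_comp_complLocalHomeomorph e hS, singularCohomology.map_comp]
  have hfst : Bijective (singularCohomology.map R R (ContinuousMap.fst : C(↥S × ℙ ℂ (F × ℂ), ↥S)) k) := by
    interval_cases k
    · exact (modelSphereLike F hF).map_fst_bijective_zero R R (U := ↥S)
    · exact (modelSphereLike F hF).map_fst_bijective_one R R (U := ↥S)
  exact (singularCohomology.mapIso R R (complLocalHomeomorph e hS) k).toLinearEquiv.bijective.comp hfst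

/-- **The local input of the engine**: over any `S` inside a trivialising set, the Leray–Hirsch
comparison map with the classes `1, t` is bijective in every degree (degrees `≥ 2`:
`thomSplitOn_bijective`; degrees `≤ 1`: `π^*` bijective). [cite: HusemollerFibreBundles1994, Ch. 17 §1 Thm. 1.1 (local case)] -/
theorem isLH_of_subset_baseSet {S : Set B} (hS : S ⊆ e.baseSet) (t : singularCohomology R R (ProjCompl F E) 2)
    (ht : ∀ b : B, singularCohomology.map R R (complFibreIncl F E b) 2 t = omegaFib F E hF R R b 1) :
    IsLH R (evenDeg 2) (complProj F E) (thomPair F E R t) S := by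
  intro k
  set tS : singularCohomology R R ↥(complPreimage F E S) 2 :=
    singularCohomology.map R R (subsetIncl (complPreimage F E S)) 2 t with htS_def
  have htS : ∀ (b : B) (hb : b ∈ S), singularCohomology.map R R (complFibOn hb) 2 tS = omegaFib F E hF R R b 1 := fun b hb ↦ by
    rw [htS_def, ← ModuleCat.comp_apply, ← singularCohomology.map_comp]
    exact ht b
  have hc0 : resCls (complProj F E) S (thomPair F E R t) 0 = singularCohomology.one R ↥((complProj F E) ⁻¹' S) :=
    singularCohomology.map_one _
  rcases Nat.lt_or_ge k 2 with hk | hk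
  · rw [bijective_lhMap_lt_two_iff R _ _ hk]
    have e1 : (fun x : singularCohomology R R ↥S k ↦ cupProduct (show k + 0 = k from rfl)
        (singularCohomology.map R R (resMap (complProj F E) S) k x) (resCls (complProj F E) S (thomPair F E R t) 0)) =
        singularCohomology.map R R (complProjOn F E S) k := by
      funext x
      rw [hc0, cupProduct_one]
      rfl
    rw [e1]
    exact map_complProjOn_bijective_of_le_one F E hF R e hS (by omega)
  · obtain ⟨m, rfl⟩ := Nat.exists_eq_add_of_le' hk
    rw [bijective_lhMap_pair_iff R _ _ m]
    have e2 : (fun x : singularCohomology R R ↥S (m + 2) × singularCohomology R R ↥S m ↦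
        cupProduct (show (m + 2) + 0 = m + 2 from rfl) (singularCohomology.map R R (resMap (complProj F E) S) (m + 2) x.1)
            (resCls (complProj F E) S (thomPair F E R t) 0) +
          cupProduct (show m + 2 = m + 2 from rfl) (singularCohomology.map R R (resMap (complProj F E) S) m x.2)
            (resCls (complProj F E) S (thomPair F E R t) 1)) = thomSplitOn F E R tS m := by
      funext x
      obtain ⟨a, b⟩ := x
      rw [thomSplitOn_apply, hc0, cupProduct_one]
      rfl
    rw [e2]
    exact thomSplitOn_bijective F E hF R e hS tS htS m

end Local

variable [T2Space B] [ParacompactSpace B]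

/-- **Leray–Hirsch for `P(λ ⊕ ℂ) → B` with the classes `1, t`** over a paracompact Hausdorff base:
the comparison map is bijective in every degree. [cite: HusemollerFibreBundles1994, Ch. 17 §1 Thm. 1.1, §2 Thm. 2.5] [cite: MilnorStasheff1974, §10 Thm. 10.4] -/
theorem lhMap_thomPair_bijective (t : singularCohomology R R (ProjCompl F E) 2)
    (ht : ∀ b : B, singularCohomology.map R R (complFibreIncl F E b) 2 t = omegaFib F E hF R R b 1) (k : ℕ) :
    Bijective (lhMap R (evenDeg 2) (complProj F E) (thomPair F E R t) k) :=
  bijective_of_cover R (evenDeg 2) (complProj F E) (thomPair F E R t) (fun i : AtlasIndex F E ↦ i.1.baseSet)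
    (fun i ↦ i.1.open_baseSet) (iUnion_baseSet_eq_univ F E)
    (fun i W _ hWi ↦ by haveI := i.2; exact isLH_of_subset_baseSet F E hF R i.1 hWi t ht) k

/-- **The Thom splitting in all degrees** (Milnor–Stasheff Thm. 10.4 in the projective-completion
model; Husemoller 17 Thm. 2.5 for `n = 2`): for `t ∈ H²(P(λ ⊕ ℂ); R)` with the fibre restrictions of a
Thom class, `(x, y) ↦ π^*x + π^*y ⌣ t : Hᵏ⁺²(B) × Hᵏ(B) → Hᵏ⁺²(P(λ ⊕ ℂ))` is bijective.
[cite: MilnorStasheff1974, §10 Thm. 10.4] [cite: HusemollerFibreBundles1994, Ch. 17 §2 Thm. 2.5] -/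
theorem thomSplit_bijective (t : singularCohomology R R (ProjCompl F E) 2)
    (ht : ∀ b : B, singularCohomology.map R R (complFibreIncl F E b) 2 t = omegaFib F E hF R R b 1) (k : ℕ) :
    Bijective fun x : singularCohomology R R B (k + 2) × singularCohomology R R B k ↦
      singularCohomology.map R R (complProj F E) (k + 2) x.1 +
        cupProduct (show k + 2 = k + 2 from rfl) (singularCohomology.map R R (complProj F E) k x.2) t := by
  have h := (bijective_lhMap_pair_iff R (complProj F E) (thomPair F E R t) k).1 (lhMap_thomPair_bijective F E hF R t ht (k + 2))
  have e : (fun x : singularCohomology R R B (k + 2) × singularCohomology R R B k ↦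
      cupProduct (show (k + 2) + 0 = k + 2 from rfl) (singularCohomology.map R R (complProj F E) (k + 2) x.1) (thomPair F E R t 0) +
        cupProduct (show k + 2 = k + 2 from rfl) (singularCohomology.map R R (complProj F E) k x.2) (thomPair F E R t 1)) =
      fun x ↦ singularCohomology.map R R (complProj F E) (k + 2) x.1 +
        cupProduct (show k + 2 = k + 2 from rfl) (singularCohomology.map R R (complProj F E) k x.2) t := by
    funext x
    rw [thomPair, pairCls_zero, cupProduct_one]
    rfl
  rw [e] at h
  exact h

variable {F E hF R} in
/-- The Thom splitting for a Thom class. [cite: MilnorStasheff1974, §10 Thm. 10.4] -/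
theorem IsThomClass.thomSplit_bijective {t : singularCohomology R R (ProjCompl F E) 2} (ht : IsThomClass F E hF R 1 t) (k : ℕ) :
    Bijective fun x : singularCohomology R R B (k + 2) × singularCohomology R R B k ↦
      singularCohomology.map R R (complProj F E) (k + 2) x.1 +
        cupProduct (show k + 2 = k + 2 from rfl) (singularCohomology.map R R (complProj F E) k x.2) t :=
  CharacteristicClasses.thomSplit_bijective F E hF R t ht.map_complFibreIncl k

include hF in
/-- **`π^* : Hᵏ(B) → Hᵏ(P(λ ⊕ ℂ))` is bijective for `k ≤ 1`** over a paracompact Hausdorff base.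
[cite: MilnorStasheff1974, §10 Thm. 10.4] -/
theorem map_complProj_bijective_of_le_one {k : ℕ} (hk : k ≤ 1) :
    Bijective (singularCohomology.map R R (complProj F E) k) := by
  obtain ⟨t, ht⟩ := exists_isThomClass F E hF R (1 : R)
  have h := (bijective_lhMap_lt_two_iff R (complProj F E) (thomPair F E R t) (show k < 2 by omega)).1
    (lhMap_thomPair_bijective F E hF R t ht.map_complFibreIncl k)
  have e : (fun x : singularCohomology R R B k ↦
      cupProduct (show k + 0 = k from rfl) (singularCohomology.map R R (complProj F E) k x) (thomPair F E R t 0)) =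
      singularCohomology.map R R (complProj F E) k := by
    funext x
    rw [thomPair, pairCls_zero, cupProduct_one]
  rw [e] at h
  exact h

end Literature.AlgebraicTopology.CharacteristicClasses
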